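import Summits.BirchSwinnertonDyer.Rank1Residual.X5.TwoAdicInstancesMultAnchorsS
import Summits.BirchSwinnertonDyer.Rank1Residual.X5.TwoAdicInstances144027d
import Summits.BirchSwinnertonDyer.Rank1Residual.X5.TwoAdicInstancesToolkitC
import Summits.BirchSwinnertonDyer.Rank1Residual.X5.TwoAdicInstancesToolkitD
import HarnessLib

/-!
# X5 at `p = 2` (cell `bsd-2adic`, seat `bsd-2adic-t42`, GEN 7): NON-SPLIT ANCHORS `14a2`, `30a5` for DOOR (34-GV-mult) — curve data only

HONEST FRAMING (cell `bsd-2adic`, run/shared/lean/pub/bsd-2adic/, HUMAN RULINGS D-0036 / D-0054): research route; NO door theorem,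
nothing displayed, nothing booked; BSD is not proved by any of this. PARTITION: X5@2 multiplicative (K4ᵐ, RESIDUAL-MAP B1·O1;
tranche 1 of the GV-mult habitat) × p = 2 — types-the-object-of (anchor curves for the congruence transport; closes none).
WHAT: the non-split multiplicative ANCHORS (`2 ∥ N`, `r = 0`, exactly one rational `2`-torsion point, of Greenberg type A or B) that the
tranche-1 classes of HOME/t42/DESIGN-T42-ADDENDUM-8.md need and that are NOT in the mult lane's anchors files
`X5/TwoAdicInstancesMultAnchors{A,B,C,S}.lean` (one writer per object: those files are imported elsewhere, never edited; planner word
2026-08-27T03:25:10Z (A) «if a class needs a NEW anchor, add it in a t42 anchors file»). Per anchor, DECIDED BY THE KERNEL: minimality,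
ellipticity, NON-SPLIT multiplicative reduction at `2`, the conductor (squarefree: coprimality; additive `3`: Rizzo's Table II in the kernel;
additive `ℓ ≥ 5`: `f = 2`), the unique rational `2`-torsion point and its Greenberg type, `2 ∣ #Ẽ(𝔽_ℓ)` at good odd `ℓ`. The anchors'
λ-invariant enters the doors ONLY through the displayed certificate binders `hlanA : λ_an(A) = 0`, `hμanA` of the class files (rows:
engine-1 kit j268238 (GVM-cert.gp @e1208179ed243b20 verbatim: LAW PASS, MU0 YES) + engine-2 kit j268244 (afe2_engine.gp v2 @9fa2375668e227f7: verdict OK, STABLE) — two-engine, t42 GEN 7) — EVIDENCE, never facts. Emitter: HOME/t42/gen/gen_anchorsfile.py + memberdata.py (port of the mult lane's genlaw5.py member block).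
WHAT THIS IS NOT: not a door, not a certificate, not a discharge of anything.

References: [SilvermanAEC2009] VII.1, VII.3.1, VII.5.1, III.1–III.2; [Silverman1994] IV.10.2; [GreenbergLNM1716] §5, Prop. 5.14;
[GreenbergVatsal2000] p. 4 (anchors); [CremonaAlgorithms1997] Table 1 (14a2, 30a5); [Rizzo2003] Table II.
-/

set_option autoImplicit false

open IsDedekindDomain WeierstrassCurve Literature.NumberTheory.EllipticCurves
  Literature.NumberTheory.EllipticCurves.ModularForms
  Literature.NumberTheory.EllipticCurves.Rank1Residual
  Literature.NumberTheory.EllipticCurves.Rank1Residual.Typed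
  Literature.NumberTheory.EllipticCurves.Greenberg1999
  Literature.NumberTheory.EllipticCurves.PolyCert
  Literature.NumberTheory.EllipticCurves.Rank1Residual.X11RankOneCertificates
  Summit.BirchSwinnertonDyer.Rank1Residual.X1.MuPart
  Summit.BirchSwinnertonDyer.Rank1Residual.X1.ParitySqueeze
  Summit.BirchSwinnertonDyer.Rank1Residual.X5.O1

open CongruenceSubgroup
open scoped MatrixGroups ModularForm

namespace Summit.BirchSwinnertonDyer.Rank1Residual.X5.Instances

/-! ## Anchor `14a2` (`N = 14`, non-split at `2`, type A, `x(P) = -9/4`) -/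

/-- Cremona `14a2` = `[1, 0, 1, -36, -70]` (integer model). [cite: CremonaAlgorithms1997, Table 1] -/
abbrev M14a2 : WeierstrassCurve ℤ := ⟨1, 0, 1, -36, -70⟩
/-- `14a2 / ℚ`. [cite: CremonaAlgorithms1997, Table 1] -/
abbrev c14a2 : WeierstrassCurve ℚ := M14a2.baseChange ℚ
/-- `Δ(14a2) = 2^3·7^6`. [cite: CremonaAlgorithms1997, Table 1] -/
theorem M14a2_Δ : M14a2.Δ = 941192 := by decide
/-- `c₄(14a2)` (`|c₄| = 5·11·31`). [cite: CremonaAlgorithms1997, Table 1] -/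
theorem M14a2_c₄ : M14a2.c₄ = 1705 := by decide
/-- `14a2` is an elliptic curve. [cite: CremonaAlgorithms1997, Table 1] -/
instance c14a2_isElliptic : c14a2.IsElliptic := by
  rw [WeierstrassCurve.isElliptic_iff, baseChange_int_Δ, M14a2_Δ]; norm_num
/-- Cremona's model `14a2` is globally minimal (`gcd(Δ, c₄) = 1`). [cite: SilvermanAEC2009, VII.1 Remark 1.1] -/
instance c14a2_isGloballyMinimal : c14a2.IsGloballyMinimal :=
  isGloballyMinimal_baseChange_int_of_gcd_eq_one 1 0 1 (-36) (-70) (by decide)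
/-- **`14a2` is multiplicative at `2`** (`2 ∣ Δ`, `2 ∤ c₄`). [cite: SilvermanAEC2009, VII.5 Prop. 5.1(b)] -/
theorem mult_two_14a2 : Mult c14a2 2 := by
  have hgen : Rat.HeightOneSpectrum.natGenerator
      ((Rat.HeightOneSpectrum.primesEquiv (R := ℤ)).symm ⟨2, Nat.prime_two⟩) = 2 :=
    Literature.NumberTheory.EllipticCurves.Rat.natGenerator_primesEquiv_symm ⟨2, Nat.prime_two⟩
  have hm : c14a2.HasMultiplicativeReductionAt
      ((Rat.HeightOneSpectrum.primesEquiv (R := ℤ)).symm ⟨2, Nat.prime_two⟩) := by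
    refine hasMultiplicativeReductionAt_of_valuation_c₄_eq_one (isIntegralAt_baseChange _ M14a2) ?_ ?_
    · rw [baseChange_int_c₄, Literature.NumberTheory.EllipticCurves.Rat.valuation_intCast_eq_one_iff, hgen,
        M14a2_c₄]; decide
    · rw [baseChange_int_Δ, Literature.NumberTheory.EllipticCurves.Rat.valuation_intCast_lt_one_iff, hgen,
        M14a2_Δ]; decide
  exact (hasMultiplicativeReductionAtPrime_iff_hasMultiplicativeReductionAt_holds c14a2
    ⟨2, Nat.prime_two⟩).mpr hm
/-- `14a2 mod 2`. [folklore] -/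
theorem M14a2_mod_two : M14a2.map (Int.castRingHom (ZMod 2)) = ⟨1, 0, 1, 0, 0⟩ := by
  ext <;> decide
/-- **`14a2` is NON-SPLIT multiplicative at `2`** (the node quadratic `X² + X + 1` has no root in `𝔽₂`). [cite: SilvermanAEC2009, VII.5 Prop. 5.1(b)] -/
theorem not_split_two_14a2 : ¬ c14a2.HasSplitMultiplicativeReductionAtPrime 2 := by
  have hint : integralModelInt c14a2 = M14a2 := integralModelInt_baseChange_int M14a2
  have hΔ : ((2 : ℕ) : ℤ) ∣ (integralModelInt c14a2).Δ := by rw [hint, M14a2_Δ]; decide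
  have hc₄ : ¬ ((2 : ℕ) : ℤ) ∣ (integralModelInt c14a2).c₄ := by rw [hint, M14a2_c₄]; decide
  rw [LocalTorsionMult.hasSplitMultiplicativeReductionAtPrime_iff_splits_integralModelInt c14a2 2 hΔ
    hc₄, hint, M14a2_mod_two]
  dsimp only
  rw [sub_eq_add_neg, ← Polynomial.C_neg]
  exact not_splits_quadratic_F2 (by decide) (by decide) (by decide)
/-- `Δ(14a2)`, `c₄(14a2)` coprime (semistable model). [cite: SilvermanAEC2009, VII.5 Prop. 5.1(b)] -/
theorem M14a2_coprime : IsCoprime M14a2.Δ M14a2.c₄ := by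
  rw [M14a2_Δ, M14a2_c₄, Int.isCoprime_iff_gcd_eq_one]; decide
/-- **The conductor of `14a2` is `14`** (semistable: the radical of `Δ`; Silverman ATAEC IV.10.2). [cite: CremonaAlgorithms1997, Table 1] [cite: Silverman1994, IV.10.2] -/
theorem conductorNorm_14a2 : c14a2.conductorNorm ℤ = 14 := by
  refine conductorNorm_baseChange_int_of_isCoprime M14a2 M14a2_coprime (k := 6) ?_ ?_ ?_
  · rw [Nat.squarefree_iff_nodup_primeFactorsList (by norm_num)]; simp
  · rw [M14a2_Δ]; decide
  · rw [M14a2_Δ]; decide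

/-- The coefficients of `14a2 / ℚ` (unfolded). [cite: CremonaAlgorithms1997, Table 1] -/
theorem c14a2_eq : c14a2 = ⟨1, 0, 1, -36, -70⟩ := by
  rw [c14a2, baseChange_int_eq]; norm_num
/-- `b₂, b₄, b₆` of `14a2`; `2`-division cubic `= (x − (-9 / 4))(4x² + ((-8))x + ((-124)))`. [cite: SilvermanAEC2009, III.1] -/
theorem c14a2_b : c14a2.b₂ = 1 ∧ c14a2.b₄ = -71 ∧ c14a2.b₆ = -279 := by
  rw [c14a2_eq]
  simp only [WeierstrassCurve.b₂, WeierstrassCurve.b₄, WeierstrassCurve.b₆]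
  norm_num
/-- The rational point `(-9/4, 5/8)` of order `2` on `14a2`. [cite: CremonaAlgorithms1997, Table 1] -/
theorem c14a2_P : c14a2.toAffine.Equation (-9 / 4) (5 / 8) ∧
    2 * ((5 / 8) : ℚ) + c14a2.a₁ * (-9 / 4) + c14a2.a₃ = 0 := by
  rw [c14a2_eq, WeierstrassCurve.Affine.equation_iff]; norm_num
/-- **`(-9/4, 5/8)` is the ONLY rational point of order `2` on `14a2`** (the cofactor `4x² + ((-8))x + ((-124))` has non-square discriminant). [cite: SilvermanAEC2009, III.2.3] -/
theorem c14a2_unique : HasUniqueRationalTwoTorsionX c14a2 (-9 / 4) := by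
  refine ⟨⟨(5 / 8), c14a2_P⟩, fun z hz ↦ ?_⟩
  have hc := cubic_eq_zero_of_hasRationalTwoTorsionX hz
  obtain ⟨hb₂, hb₄, hb₆⟩ := c14a2_b
  rw [hb₂, hb₄, hb₆] at hc
  have hfac : (z - (-9 / 4)) * (4 * z ^ 2 + (-8) * z + (-124)) = 0 := by linear_combination hc
  exact eq_of_cubic_factor_of_not_isSquare z hfac (by norm_num)
/-- `(-9/4, ·)` is "ramified at `2`" (`v₂(x) = −2`). [cite: GreenbergLNM1716, §5 (chunk p0176)] -/
theorem c14a2_ram : TwoTorsionRamifiedAtTwo ((-9 / 4) : ℚ) := by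
  have := twoTorsionRamifiedAtTwo_of_odd_div_four (-9) (by decide)
  push_cast at this
  simpa [neg_div] using this
/-- `(-9/4, ·)` is NOT "odd": `(−u − √(u² − 16v))/8 < -9/4` is a smaller real root of the `2`-division cubic (`u = -8`, `v = -124`).
[cite: GreenbergLNM1716, §5 Remark (chunk p0174)] -/
theorem c14a2_not_odd : ¬ TwoTorsionOdd c14a2 (-9 / 4) := by
  intro hodd
  obtain ⟨hb₂, hb₄, hb₆⟩ := c14a2_b
  obtain ⟨r, hr, hlt⟩ := exists_cubic_root_lt (x₀ := ((-9 / 4) : ℝ)) (u := (-8)) (v := (-124)) (by norm_num)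
    ((Real.lt_sqrt (by norm_num)).mpr (by norm_num))
  have := hodd r (by rw [hb₂, hb₄, hb₆]; push_cast; linear_combination hr)
  push_cast at this
  linarith
/-- **`(-9/4, ·)` is of Greenberg type A** (ramified at `2`, not odd). [cite: GreenbergLNM1716, Prop. 5.14 (p. 171)] -/
theorem c14a2_typeAB : (TwoTorsionRamifiedAtTwo ((-9 / 4) : ℚ) ∧ ¬ TwoTorsionOdd c14a2 (-9 / 4)) ∨
    (TwoTorsionOdd c14a2 (-9 / 4) ∧ ¬ TwoTorsionRamifiedAtTwo ((-9 / 4) : ℚ)) :=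
  Or.inl ⟨c14a2_ram, c14a2_not_odd⟩

/-- `2 ∣ #Ẽ(𝔽_ℓ)` for `14a2` at every good odd prime `ℓ` (a rational `2`-torsion point). [cite: SilvermanAEC2009, VII.3.1(b)] -/
theorem two_dvd_reductionPointCount_14a2 {ℓ : ℕ} [Fact ℓ.Prime] (hℓ : 3 ≤ ℓ)
    (hΔ : ¬ (ℓ : ℤ) ∣ (941192 : ℤ)) : 2 ∣ c14a2.reductionPointCount ℓ :=
  two_dvd_reductionPointCount_of_hasRationalTwoTorsionX ⟨(5 / 8), c14a2_P⟩ hℓ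
    (by rw [minimalDiscriminantInt_baseChange_int, M14a2_Δ]; exact hΔ)

/-! ## Anchor `30a5` (`N = 30`, non-split at `2`, type A, `x(P) = 39/4`) -/

/-- Cremona `30a5` = `[1, 0, 1, -289, 1862]` (integer model). [cite: CremonaAlgorithms1997, Table 1] -/
abbrev M30a5 : WeierstrassCurve ℤ := ⟨1, 0, 1, -289, 1862⟩
/-- `30a5 / ℚ`. [cite: CremonaAlgorithms1997, Table 1] -/
abbrev c30a5 : WeierstrassCurve ℚ := M30a5.baseChange ℚ
/-- `Δ(30a5) = 2·3^3·5^4`. [cite: CremonaAlgorithms1997, Table 1] -/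
theorem M30a5_Δ : M30a5.Δ = 33750 := by decide
/-- `c₄(30a5)` (`|c₄| = 11·1259`). [cite: CremonaAlgorithms1997, Table 1] -/
theorem M30a5_c₄ : M30a5.c₄ = 13849 := by decide
/-- `30a5` is an elliptic curve. [cite: CremonaAlgorithms1997, Table 1] -/
instance c30a5_isElliptic : c30a5.IsElliptic := by
  rw [WeierstrassCurve.isElliptic_iff, baseChange_int_Δ, M30a5_Δ]; norm_num
/-- Cremona's model `30a5` is globally minimal (`gcd(Δ, c₄) = 1`). [cite: SilvermanAEC2009, VII.1 Remark 1.1] -/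
instance c30a5_isGloballyMinimal : c30a5.IsGloballyMinimal :=
  isGloballyMinimal_baseChange_int_of_gcd_eq_one 1 0 1 (-289) 1862 (by decide)
/-- **`30a5` is multiplicative at `2`** (`2 ∣ Δ`, `2 ∤ c₄`). [cite: SilvermanAEC2009, VII.5 Prop. 5.1(b)] -/
theorem mult_two_30a5 : Mult c30a5 2 := by
  have hgen : Rat.HeightOneSpectrum.natGenerator
      ((Rat.HeightOneSpectrum.primesEquiv (R := ℤ)).symm ⟨2, Nat.prime_two⟩) = 2 :=
    Literature.NumberTheory.EllipticCurves.Rat.natGenerator_primesEquiv_symm ⟨2, Nat.prime_two⟩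
  have hm : c30a5.HasMultiplicativeReductionAt
      ((Rat.HeightOneSpectrum.primesEquiv (R := ℤ)).symm ⟨2, Nat.prime_two⟩) := by
    refine hasMultiplicativeReductionAt_of_valuation_c₄_eq_one (isIntegralAt_baseChange _ M30a5) ?_ ?_
    · rw [baseChange_int_c₄, Literature.NumberTheory.EllipticCurves.Rat.valuation_intCast_eq_one_iff, hgen,
        M30a5_c₄]; decide
    · rw [baseChange_int_Δ, Literature.NumberTheory.EllipticCurves.Rat.valuation_intCast_lt_one_iff, hgen,
        M30a5_Δ]; decide
  exact (hasMultiplicativeReductionAtPrime_iff_hasMultiplicativeReductionAt_holds c30a5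
    ⟨2, Nat.prime_two⟩).mpr hm
/-- `30a5 mod 2`. [folklore] -/
theorem M30a5_mod_two : M30a5.map (Int.castRingHom (ZMod 2)) = ⟨1, 0, 1, 1, 0⟩ := by
  ext <;> decide
/-- **`30a5` is NON-SPLIT multiplicative at `2`** (the node quadratic `X² + X + 1` has no root in `𝔽₂`). [cite: SilvermanAEC2009, VII.5 Prop. 5.1(b)] -/
theorem not_split_two_30a5 : ¬ c30a5.HasSplitMultiplicativeReductionAtPrime 2 := by
  have hint : integralModelInt c30a5 = M30a5 := integralModelInt_baseChange_int M30a5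
  have hΔ : ((2 : ℕ) : ℤ) ∣ (integralModelInt c30a5).Δ := by rw [hint, M30a5_Δ]; decide
  have hc₄ : ¬ ((2 : ℕ) : ℤ) ∣ (integralModelInt c30a5).c₄ := by rw [hint, M30a5_c₄]; decide
  rw [LocalTorsionMult.hasSplitMultiplicativeReductionAtPrime_iff_splits_integralModelInt c30a5 2 hΔ
    hc₄, hint, M30a5_mod_two]
  dsimp only
  rw [sub_eq_add_neg, ← Polynomial.C_neg]
  exact not_splits_quadratic_F2 (by decide) (by decide) (by decide)
/-- `Δ(30a5)`, `c₄(30a5)` coprime (semistable model). [cite: SilvermanAEC2009, VII.5 Prop. 5.1(b)] -/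
theorem M30a5_coprime : IsCoprime M30a5.Δ M30a5.c₄ := by
  rw [M30a5_Δ, M30a5_c₄, Int.isCoprime_iff_gcd_eq_one]; decide
/-- **The conductor of `30a5` is `30`** (semistable: the radical of `Δ`; Silverman ATAEC IV.10.2). [cite: CremonaAlgorithms1997, Table 1] [cite: Silverman1994, IV.10.2] -/
theorem conductorNorm_30a5 : c30a5.conductorNorm ℤ = 30 := by
  refine conductorNorm_baseChange_int_of_isCoprime M30a5 M30a5_coprime (k := 4) ?_ ?_ ?_
  · rw [Nat.squarefree_iff_nodup_primeFactorsList (by norm_num)]; simp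
  · rw [M30a5_Δ]; decide
  · rw [M30a5_Δ]; decide

/-- The coefficients of `30a5 / ℚ` (unfolded). [cite: CremonaAlgorithms1997, Table 1] -/
theorem c30a5_eq : c30a5 = ⟨1, 0, 1, -289, 1862⟩ := by
  rw [c30a5, baseChange_int_eq]; norm_num
/-- `b₂, b₄, b₆` of `30a5`; `2`-division cubic `= (x − (39 / 4))(4x² + (40)x + ((-764)))`. [cite: SilvermanAEC2009, III.1] -/
theorem c30a5_b : c30a5.b₂ = 1 ∧ c30a5.b₄ = -577 ∧ c30a5.b₆ = 7449 := by
  rw [c30a5_eq]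
  simp only [WeierstrassCurve.b₂, WeierstrassCurve.b₄, WeierstrassCurve.b₆]
  norm_num
/-- The rational point `(39/4, -43/8)` of order `2` on `30a5`. [cite: CremonaAlgorithms1997, Table 1] -/
theorem c30a5_P : c30a5.toAffine.Equation (39 / 4) (-43 / 8) ∧
    2 * ((-43 / 8) : ℚ) + c30a5.a₁ * (39 / 4) + c30a5.a₃ = 0 := by
  rw [c30a5_eq, WeierstrassCurve.Affine.equation_iff]; norm_num
/-- **`(39/4, -43/8)` is the ONLY rational point of order `2` on `30a5`** (the cofactor `4x² + (40)x + ((-764))` has non-square discriminant). [cite: SilvermanAEC2009, III.2.3] -/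
theorem c30a5_unique : HasUniqueRationalTwoTorsionX c30a5 (39 / 4) := by
  refine ⟨⟨(-43 / 8), c30a5_P⟩, fun z hz ↦ ?_⟩
  have hc := cubic_eq_zero_of_hasRationalTwoTorsionX hz
  obtain ⟨hb₂, hb₄, hb₆⟩ := c30a5_b
  rw [hb₂, hb₄, hb₆] at hc
  have hfac : (z - (39 / 4)) * (4 * z ^ 2 + 40 * z + (-764)) = 0 := by linear_combination hc
  exact eq_of_cubic_factor_of_not_isSquare z hfac (by norm_num)
/-- `(39/4, ·)` is "ramified at `2`" (`v₂(x) = −2`). [cite: GreenbergLNM1716, §5 (chunk p0176)] -/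
theorem c30a5_ram : TwoTorsionRamifiedAtTwo ((39 / 4) : ℚ) := by
  have := twoTorsionRamifiedAtTwo_of_odd_div_four (39) (by decide)
  push_cast at this
  simpa [neg_div] using this
/-- `(39/4, ·)` is NOT "odd": `(−u − √(u² − 16v))/8 < 39/4` is a smaller real root of the `2`-division cubic (`u = 40`, `v = -764`).
[cite: GreenbergLNM1716, §5 Remark (chunk p0174)] -/
theorem c30a5_not_odd : ¬ TwoTorsionOdd c30a5 (39 / 4) := by
  intro hodd
  obtain ⟨hb₂, hb₄, hb₆⟩ := c30a5_b
  obtain ⟨r, hr, hlt⟩ := exists_cubic_root_lt (x₀ := ((39 / 4) : ℝ)) (u := 40) (v := (-764)) (by norm_num)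
    (lt_of_lt_of_le (by norm_num) (Real.sqrt_nonneg _))
  have := hodd r (by rw [hb₂, hb₄, hb₆]; push_cast; linear_combination hr)
  push_cast at this
  linarith
/-- **`(39/4, ·)` is of Greenberg type A** (ramified at `2`, not odd). [cite: GreenbergLNM1716, Prop. 5.14 (p. 171)] -/
theorem c30a5_typeAB : (TwoTorsionRamifiedAtTwo ((39 / 4) : ℚ) ∧ ¬ TwoTorsionOdd c30a5 (39 / 4)) ∨
    (TwoTorsionOdd c30a5 (39 / 4) ∧ ¬ TwoTorsionRamifiedAtTwo ((39 / 4) : ℚ)) :=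
  Or.inl ⟨c30a5_ram, c30a5_not_odd⟩

/-- `2 ∣ #Ẽ(𝔽_ℓ)` for `30a5` at every good odd prime `ℓ` (a rational `2`-torsion point). [cite: SilvermanAEC2009, VII.3.1(b)] -/
theorem two_dvd_reductionPointCount_30a5 {ℓ : ℕ} [Fact ℓ.Prime] (hℓ : 3 ≤ ℓ)
    (hΔ : ¬ (ℓ : ℤ) ∣ (33750 : ℤ)) : 2 ∣ c30a5.reductionPointCount ℓ :=
  two_dvd_reductionPointCount_of_hasRationalTwoTorsionX ⟨(-43 / 8), c30a5_P⟩ hℓ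
    (by rw [minimalDiscriminantInt_baseChange_int, M30a5_Δ]; exact hΔ)

end Summit.BirchSwinnertonDyer.Rank1Residual.X5.Instances
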